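import Summits.BirchSwinnertonDyer.BirchSwinnertonDyer.Theorems.CyclotomicUntwistPSUntwistedTraceDefs
import Summits.BirchSwinnertonDyer.BirchSwinnertonDyer.Theorems.CyclotomicUntwistPSRootNumberThree
import HarnessLib

/-!
# LAW L-a3 (kernel): the untwisted trace `a_w(W)` on the cyclic wild cell at `3`, read off the integral minimal
# model — the four-row closed form, the forced sign datum `c₆ᵘ ≡ ±4 (mod 9)` on `II`/`IV*`, and the `a_w = 0` sub-rows
# (route `CyclotomicUntwist`, cruxes K1 `PSRankOneLowerHalfAtThree` / K2 `PSRankOneUpperHalfAtThree`)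

Cell `pub/bsd-wall` (D-0145 line `route-BirchSwinnertonDyer-CyclotomicUntwist`), seat `bsd-line-cycu-p3` (gen 6).
Helper toward K1 (stmt-BirchSwinnertonDyer-21580) / K2 (stmt-21581). THEOREMS ONLY (no definition, no named fact,
no `sorry`); BSD is not proved by this file and no crux is. One more entry of the Tate-algorithm-at-`3` dictionary of
the principal-series rows (`PSKodairaDictionary` f₃/Kodaira, LAW L-c3 `PSTamagawaThree`, LAW L-t3 `PSLocalThreeTorsion`,
LAW L-w3 `PSRootNumberThree`, LAW L-tw3 `PSTwistInvolution`): the UNTWISTED TRACE `a_w` of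
`CyclotomicUntwistPSUntwistedTraceDefs` (`W.psUntwistedTrace`, defined on the invariants `c₆, Δ` of any equation).

Notation: `W/ℚ` elliptic, globally minimal; `W_ℤ := integralModelInt W`; `v := v₃(Δ_min)`;
`Δ′ := Δ_min/3^v` (`minimalDiscUnitPartThree W`); `c₆ᵘ := c₆(W_ℤ)/3^{v₃ c₆(W_ℤ)}` (the unit part, the currency of
LAW L-c3's `three_dvd_localTamagawaNumber_three_iff_of_psRow`); `s, e, T` the residue tables `signNine`, `epsNine`,
`traceTableIV` of the Defs file.

## What is proved

* §1 kernels: `emod_nine_eq_four_or_five_of_kernel` — `192·d = a³ − b²`, `3 ∤ ab`, `d ≡ 1 (mod 3)` ⟹ `b ≡ ±4 (mod 9)`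
  (`decide` over `ℤ/9`: unit cubes are `±1`, `192 ≡ 3`, the only unit square `≡ ±1 − 3` is `7 = (±4)²`); residue
  bookkeeping for `s, e, T`.
* §2 `res9_Δ_eq` (`res9 Δ(W) = Δ′ mod 9`), `res9_c₆_eq` (`res9 c₆(W) = c₆ᵘ mod 9`), `integralModelInt_c₆_ne_zero_of_even`;
  **`psUntwistedTrace_of_even`** / **`psUntwistedTrace_of_psRow`**: on the cyclic wild cell (`Addv W 3`, `SubW W 3`,
  `v` even; in particular on the PS rows of K1/K2, binders `ClassO6 W 3`, `v` even, `Δ′ ≡ 1 (mod 3)`)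
  `a_w(W) = 3·s(c₆ᵘ)·e(Δ′)` (`v = 4`, II) · `T(c₆ᵘ)` (`v = 6`, IV) · `−3·s(c₆ᵘ)·e(Δ′)` (`v = 10`, IV*) · `−T(c₆ᵘ)`
  (`v = 12`, II*), residues mod `9`;
  **`c₆_unitPart_emod_nine_of_psRow_II_IVstar`**: on the PS `II`/`IV*` rows `c₆ᵘ ≡ ±4 (mod 9)` (Table II pins
  `(v₃c₄, v₃c₆) = (2,3)` / `(4,6)`, the `c`-relation of `W_ℤ` gives `192·Δ′ = c₄ᵘ³ − c₆ᵘ²`), so the sign `s` is `±1`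
  there and never junk;
  **`psUntwistedTrace_eq_zero_iff_of_psRow_II_IVstar`: `a_w = 0 ⟺ Δ′ ≡ 7 (mod 9)`** on the PS `II`/`IV*` rows, and
  **`psUntwistedTrace_eq_zero_iff_of_even_IV_IIstar`: `a_w = 0 ⟺ c₆ᵘ ≡ ±4 (mod 9)`** on the `IV`/`II*` rows — the
  curve-side predicate of the `a_w = 0` third of the rows (memo LAW-La3-KERNEL-v3 §8: `133` of the `416` K1/K2 classes
  with `N < 5·10⁵`; there `ℚ₃(E[2]) = ℚ₃(ζ₉)⁺` and the untwisted eigenvalue has `α² = −3`, `κ = −3·W₃ ∈ ℚ`).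

## Reading for the route (informal; nothing of this is asserted)

With (T) of the memo (`a_w = a₃(g) + a₃(ḡ)`, `a₃(g)a₃(ḡ) = 3` for the untwist `g` — Néron–Ogg–Shafarevich, Atkin–Li,
Carayol) the intrinsic admissibility clause `α² − a_w(W)·α + 3 = 0` of the separated K1 ∧ K2 closer
(`…FiniteSlopeSeparatedPinnedIntrinsic`, p614028; σ-line form p615865) is now stated with a CONCRETE `aw`; this file
says what that clause is on each row in Kraus currency. The closed form was checked against the Tate-algorithm recipe
on all 24 420 PS curves of conductor `< 500 000` (Defs file docstring).

References: A. Kraus, Manuscripta Math. 69 (1990), Théorème (p = 3) [Kraus1990]; J. Tate, LNM 476 (1975) §7 [Tate1975];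
O. G. Rizzo, Compositio Math. 136 (2003), §1.1–1.2 and Table II [Rizzo2003]; I. Papadopoulos, J. Number Theory 44 (1993)
[Papadopoulos1993]; J. H. Silverman, *AEC* VII.1 [SilvermanAEC2009].
-/

open scoped Classical

open WeierstrassCurve IsDedekindDomain Rat.HeightOneSpectrum Literature.NumberTheory.EllipticCurves
  Literature.NumberTheory.EllipticCurves.Rank1Residual Literature.NumberTheory.DiophantineGeometry
  Summit.BirchSwinnertonDyer.Rank1Residual.Additive
  Summit.BirchSwinnertonDyer.BirchSwinnertonDyer.Theorems

-- single-conjunct summit: `Summit.BirchSwinnertonDyer.BirchSwinnertonDyer.…` repeats the name by design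
set_option linter.dupNamespace false
set_option autoImplicit false

namespace Summit.BirchSwinnertonDyer.BirchSwinnertonDyer.Theorems.PSUntwistedTrace

open PSRootNumberThreeTable PSRootNumberThree

/-! ### §1 Arithmetic kernels -/

section Kernels

/-- The `729` cases behind the sign datum: for units `x, y` of `ℤ/9` and `z ≡ 1 (mod 3)` with `192·z = x³ − y²`,
`y ≡ ±4 (mod 9)` (cubes of units are `±1`, `192 ≡ 3`, so `y² ≡ ±1 − 3 ∈ {7, 5}`, and `7` is the only square).
[folklore] -/
private theorem kernel_ps_zmod : ∀ x y z : ZMod 9,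
    ZMod.castHom (show 3 ∣ 9 by norm_num) (ZMod 3) x ≠ 0 →
    ZMod.castHom (show 3 ∣ 9 by norm_num) (ZMod 3) y ≠ 0 →
    ZMod.castHom (show 3 ∣ 9 by norm_num) (ZMod 3) z = 1 →
    192 * z = x ^ 3 - y ^ 2 → (y = 4 ∨ y = 5) := by
  decide

/-- **The sign datum is always defined on the principal-series `II`/`IV*` rows**: `192·d = a³ − b²` with
`3 ∤ a`, `3 ∤ b` and `d ≡ 1 (mod 3)` forces `b ≡ ±4 (mod 9)`. [folklore] -/
theorem emod_nine_eq_four_or_five_of_kernel {a b d : ℤ} (ha : ¬ (3 : ℤ) ∣ a) (hb : ¬ (3 : ℤ) ∣ b)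
    (hd : d % 3 = 1) (h : 192 * d = a ^ 3 - b ^ 2) : b % 9 = 4 ∨ b % 9 = 5 := by
  have ha' : ZMod.castHom (show 3 ∣ 9 by norm_num) (ZMod 3) (a : ZMod 9) ≠ 0 := by
    rw [map_intCast, Ne, ZMod.intCast_zmod_eq_zero_iff_dvd]; exact_mod_cast ha
  have hb' : ZMod.castHom (show 3 ∣ 9 by norm_num) (ZMod 3) (b : ZMod 9) ≠ 0 := by
    rw [map_intCast, Ne, ZMod.intCast_zmod_eq_zero_iff_dvd]; exact_mod_cast hb
  have hd' : ZMod.castHom (show 3 ∣ 9 by norm_num) (ZMod 3) (d : ZMod 9) = 1 := by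
    rw [map_intCast]
    have : ((d : ℤ) : ZMod 3) = ((1 : ℤ) : ZMod 3) := by
      rw [ZMod.intCast_eq_intCast_iff]
      unfold Int.ModEq; simpa using hd
    simpa using this
  have h' : (192 : ZMod 9) * (d : ZMod 9) = (a : ZMod 9) ^ 3 - (b : ZMod 9) ^ 2 := by
    have h'' := congrArg (Int.cast : ℤ → ZMod 9) h
    push_cast at h''
    exact h''
  have key := kernel_ps_zmod _ _ _ ha' hb' hd' h'
  have e4 : ((b : ZMod 9) = 4) ↔ b % 9 = 4 := by
    rw [show (4 : ZMod 9) = ((4 : ℤ) : ZMod 9) by norm_num, ZMod.intCast_eq_intCast_iff]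
    simp [Int.ModEq]
  have e5 : ((b : ZMod 9) = 5) ↔ b % 9 = 5 := by
    rw [show (5 : ZMod 9) = ((5 : ℤ) : ZMod 9) by norm_num, ZMod.intCast_eq_intCast_iff]
    simp [Int.ModEq]
  rw [e4, e5] at key
  exact key

/-- `d ≡ 1 (mod 3)` leaves `d mod 9 ∈ {1, 4, 7}`. [folklore] -/
theorem emod_nine_of_emod_three_eq_one {d : ℤ} (hd : d % 3 = 1) : d % 9 = 1 ∨ d % 9 = 4 ∨ d % 9 = 7 := by
  omega

/-- On `{4, 5}` the sign is `±1`: `s(4) = 1`, `s(5) = −1`. [folklore] -/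
theorem signNine_of_eq_four_or_five {r : ℤ} (h : r = 4 ∨ r = 5) : signNine r = 1 ∨ signNine r = -1 := by
  rcases h with rfl | rfl <;> decide

/-- On `d mod 9 ∈ {1, 4, 7}`: `e = −1, +1, 0` respectively; in particular `e = 0 ⟺ d ≡ 7 (mod 9)`. [folklore] -/
theorem epsNine_eq_zero_iff_of_mem {r : ℤ} (h : r = 1 ∨ r = 4 ∨ r = 7) : epsNine r = 0 ↔ r = 7 := by
  rcases h with rfl | rfl | rfl <;> decide

/-- A `3`-adic unit has residue mod `9` in `{1, 2, 4, 5, 7, 8}`. [folklore] -/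
theorem emod_nine_of_not_three_dvd {y : ℤ} (h : ¬ (3 : ℤ) ∣ y) :
    y % 9 = 1 ∨ y % 9 = 2 ∨ y % 9 = 4 ∨ y % 9 = 5 ∨ y % 9 = 7 ∨ y % 9 = 8 := by
  omega

/-- `T(r) = 0 ⟺ r ∈ {4, 5}` for `r` a unit residue mod `9`. [folklore] -/
theorem traceTableIV_eq_zero_iff_of_unit {r : ℤ} (h : r = 1 ∨ r = 2 ∨ r = 4 ∨ r = 5 ∨ r = 7 ∨ r = 8) :
    traceTableIV r = 0 ↔ (r = 4 ∨ r = 5) := by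
  rcases h with rfl | rfl | rfl | rfl | rfl | rfl <;> decide

end Kernels

/-! ### §2 The untwisted trace of a globally minimal curve: reading the invariants off the integral model -/

section Curves

variable (W : WeierstrassCurve ℚ) [W.IsElliptic] [W.IsGloballyMinimal]

omit [W.IsElliptic] in
/-- `v₃(Δ)` of the equation `W` (globally minimal) is `v₃(Δ_min)`, as an integer residue mod `12`. [folklore] -/
theorem padicValRat_Δ_emod_twelve :
    padicValRat 3 W.Δ % 12 = ((padicValInt 3 W.minimalDiscriminantInt : ℕ) : ℤ) % 12 := by
  rw [padicValRat_Δ_eq_padicValInt_minimalDiscriminantInt W]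

omit [W.IsElliptic] in
/-- **Rizzo's residue of `Δ` is `Δ′ mod 9`**: `res9 (Δ(W)) = (Δ_min / 3^{v₃Δ_min}) % 9` for a globally minimal `W`.
[cite: Rizzo2003, p. 2 (notation x')] -/
theorem res9_Δ_eq : Rizzo.res9 W.Δ = minimalDiscUnitPartThree W % 9 := by
  rw [← cast_minimalDiscriminantInt W]
  exact res9_intCast_eq (minimalDiscriminantInt_eq_pow_mul_unitPart W)
    (by rw [cast_minimalDiscriminantInt, padicValRat_Δ_eq_padicValInt_minimalDiscriminantInt])

omit [W.IsElliptic] in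
/-- **Rizzo's residue of `c₆` is the unit part of `c₆(W_ℤ)` mod `9`**: for the integral minimal model
`W_ℤ = integralModelInt W` with `c₆(W_ℤ) ≠ 0`, `res9 (c₆(W)) = (c₆(W_ℤ) / 3^{v₃ c₆(W_ℤ)}) % 9`.
[cite: Rizzo2003, p. 2 (notation x')] -/
theorem res9_c₆_eq (h0 : (integralModelInt W).c₆ ≠ 0) :
    Rizzo.res9 W.c₆ =
      (integralModelInt W).c₆ / 3 ^ padicValInt 3 (integralModelInt W).c₆ % 9 := by
  obtain ⟨b, hb, -⟩ := exists_eq_pow_mul_not_dvd h0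
  have hq : (integralModelInt W).c₆ / 3 ^ padicValInt 3 (integralModelInt W).c₆ = b :=
    Int.ediv_eq_of_eq_mul_right (pow_ne_zero _ (by norm_num)) hb
  rw [hq, c₆_eq_cast_integralModelInt W]
  exact res9_intCast_eq hb (by rw [padicValRat.of_int])

/-- On the wild cell at `3` (`Addv W 3`, `SubW W 3`) with `v₃(Δ_min)` even, `c₆(W_ℤ) ≠ 0` (indeed
`v₃ c₆ ∈ {3, 5, 6, 8}` by Table II; `f₃ = 4`). [cite: Rizzo2003, Table II (p. 4)] [cite: Kraus1990, Théorème (p = 3)] -/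
theorem integralModelInt_c₆_ne_zero_of_even (hadd : Addv W 3) (hW : SubW W 3)
    (hev : Even (padicValInt 3 W.minimalDiscriminantInt)) : (integralModelInt W).c₆ ≠ 0 := by
  have hf := (PSKodairaDictionary.condExp_eq_four_iff_even W hadd hW).mpr hev
  have htab := condExpOfInvariants_eq_four_of_condExp W hf
  have hvQ : padicValRat 3 W.Δ = 4 ∨ padicValRat 3 W.Δ = 6 ∨ padicValRat 3 W.Δ = 10 ∨
      padicValRat 3 W.Δ = 12 := by
    rw [padicValRat_Δ_eq_padicValInt_minimalDiscriminantInt W]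
    rcases PSKodairaDictionary.padicValInt_mem_of_even W hadd hW hev with h | h | h | h <;>
      rw [h] <;> norm_num
  obtain ⟨-, hc6, -⟩ := rows_of_condExpOfInvariants_eq_four_of_mem htab hvQ
  intro h
  exact hc6 (by rw [c₆_eq_cast_integralModelInt W, h, Int.cast_zero])

/-- **LAW L-a3 (N′) on the integral minimal model, cyclic wild cell.** For `W/ℚ` elliptic, globally minimal,
in the wild cell at `3` with `v = v₃(Δ_min)` even, writing `c₆ᵘ := c₆(W_ℤ)/3^{v₃c₆(W_ℤ)}` and
`Δ′ := Δ_min/3^v`: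
`a_w(W) = 3·s(c₆ᵘ mod 9)·e(Δ′ mod 9)` (`v = 4`), `T(c₆ᵘ mod 9)` (`v = 6`), `−3·s·e` (`v = 10`), `−T` (`v = 12`).
[cite: Kraus1990, Théorème (p = 3)] [cite: Tate1975, §7] -/
theorem psUntwistedTrace_of_even (hadd : Addv W 3) (hW : SubW W 3)
    (hev : Even (padicValInt 3 W.minimalDiscriminantInt)) :
    W.psUntwistedTrace =
      if padicValInt 3 W.minimalDiscriminantInt = 4 then
        3 * signNine ((integralModelInt W).c₆ / 3 ^ padicValInt 3 (integralModelInt W).c₆ % 9) *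
          epsNine (minimalDiscUnitPartThree W % 9)
      else if padicValInt 3 W.minimalDiscriminantInt = 6 then
        traceTableIV ((integralModelInt W).c₆ / 3 ^ padicValInt 3 (integralModelInt W).c₆ % 9)
      else if padicValInt 3 W.minimalDiscriminantInt = 10 then
        -3 * signNine ((integralModelInt W).c₆ / 3 ^ padicValInt 3 (integralModelInt W).c₆ % 9) *
          epsNine (minimalDiscUnitPartThree W % 9)
      else -traceTableIV ((integralModelInt W).c₆ / 3 ^ padicValInt 3 (integralModelInt W).c₆ % 9) := by
  have hres6 := res9_c₆_eq W (integralModelInt_c₆_ne_zero_of_even W hadd hW hev)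
  have hresΔ := res9_Δ_eq W
  have h12 := padicValRat_Δ_emod_twelve W
  rw [psUntwistedTrace_def]
  rcases PSKodairaDictionary.padicValInt_mem_of_even W hadd hW hev with h | h | h | h
  · rw [h] at h12 ⊢
    rw [untwistedTraceOfInvariants_of_four (by rw [h12]; norm_num), hres6, hresΔ]
    simp
  · rw [h] at h12 ⊢
    rw [untwistedTraceOfInvariants_of_six (by rw [h12]; norm_num), hres6]
    simp
  · rw [h] at h12 ⊢
    rw [untwistedTraceOfInvariants_of_ten (by rw [h12]; norm_num), hres6, hresΔ]
    simp
  · rw [h] at h12 ⊢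
    rw [untwistedTraceOfInvariants_of_twelve (by rw [h12]; norm_num), hres6]
    simp

/-- **The sign datum on the principal-series `II`/`IV*` rows: `c₆ᵘ ≡ ±4 (mod 9)`.** For `W` globally minimal
with `f₃ = 4`, `v₃(Δ_min) ∈ {4, 10}` and `Δ′ ≡ 1 (mod 3)`: Table II pins `(v₃c₄, v₃c₆) = (2, 3)` resp.
`(4, 6)`, the `c`-relation of `W_ℤ` reads `192·Δ′ = c₄ᵘ³ − c₆ᵘ²`, and the kernel gives `c₆ᵘ mod 9 ∈ {4, 5}`.
[cite: Rizzo2003, Table II (p. 4), rows (2,3,4), (4,6,10)] -/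
theorem c₆_unitPart_emod_nine_of_psRow_II_IVstar (hf : condExp W 3 = 4)
    (hv : padicValInt 3 W.minimalDiscriminantInt = 4 ∨ padicValInt 3 W.minimalDiscriminantInt = 10)
    (hps : minimalDiscUnitPartThree W % 3 = 1) :
    (integralModelInt W).c₆ / 3 ^ padicValInt 3 (integralModelInt W).c₆ % 9 = 4 ∨
      (integralModelInt W).c₆ / 3 ^ padicValInt 3 (integralModelInt W).c₆ % 9 = 5 := by
  have htab := condExpOfInvariants_eq_four_of_condExp W hf
  have hc₄ := c₄_eq_cast_integralModelInt W
  have hc₆ := c₆_eq_cast_integralModelInt W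
  -- the valuations `(a, b, v)` of `c₄, c₆, Δ` on the two rows
  have hrows : ∃ a b v : ℕ, padicValRat 3 W.c₄ = a ∧ padicValRat 3 W.c₆ = b ∧
      padicValInt 3 W.minimalDiscriminantInt = v ∧ 3 * a = 2 * b ∧ 2 * b = v + 2 ∧ W.c₄ ≠ 0 ∧ W.c₆ ≠ 0 := by
    rcases hv with h | h
    · have hvQ : padicValRat 3 W.Δ = 4 := by
        rw [padicValRat_Δ_eq_padicValInt_minimalDiscriminantInt W, h]; rfl
      obtain ⟨hc4, hc6, hr⟩ := rows_of_condExpOfInvariants_eq_four_of_mem htab (Or.inl hvQ)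
      rcases hr with ⟨h4, h6, -⟩ | ⟨-, -, h'⟩ | ⟨-, -, h'⟩ | ⟨-, -, h'⟩
      · exact ⟨2, 3, 4, h4, h6, h, by norm_num, by norm_num, hc4, hc6⟩
      all_goals rw [hvQ] at h'; exact absurd h' (by norm_num)
    · have hvQ : padicValRat 3 W.Δ = 10 := by
        rw [padicValRat_Δ_eq_padicValInt_minimalDiscriminantInt W, h]; rfl
      obtain ⟨hc4, hc6, hr⟩ := rows_of_condExpOfInvariants_eq_four_of_mem htab (Or.inr (Or.inr (Or.inl hvQ)))
      rcases hr with ⟨-, -, h'⟩ | ⟨-, -, h'⟩ | ⟨h4, h6, -⟩ | ⟨-, -, h'⟩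
      pick_goal 3
      · exact ⟨4, 6, 10, h4, h6, h, by norm_num, by norm_num, hc4, hc6⟩
      all_goals rw [hvQ] at h'; exact absurd h' (by norm_num)
  obtain ⟨a, b, v, h4, h6, hvv, h3a, hrel2, hc4, hc6⟩ := hrows
  have hC40 : (integralModelInt W).c₄ ≠ 0 := fun h ↦ hc4 (by rw [hc₄, h, Int.cast_zero])
  have hC60 : (integralModelInt W).c₆ ≠ 0 := fun h ↦ hc6 (by rw [hc₆, h, Int.cast_zero])
  have hva : padicValInt 3 (integralModelInt W).c₄ = a := by
    have h := h4; rw [hc₄, padicValRat.of_int] at h; exact_mod_cast h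
  have hvb : padicValInt 3 (integralModelInt W).c₆ = b := by
    have h := h6; rw [hc₆, padicValRat.of_int] at h; exact_mod_cast h
  obtain ⟨x, hx, hx3⟩ := exists_eq_pow_mul_not_dvd hC40
  obtain ⟨y, hy, hy3⟩ := exists_eq_pow_mul_not_dvd hC60
  have hyq : (integralModelInt W).c₆ / 3 ^ padicValInt 3 (integralModelInt W).c₆ = y :=
    Int.ediv_eq_of_eq_mul_right (pow_ne_zero _ (by norm_num)) hy
  rw [hyq]
  rw [hva] at hx
  rw [hvb] at hy
  have hD := minimalDiscriminantInt_eq_pow_mul_unitPart W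
  rw [hvv] at hD
  have hrel : 1728 * W.minimalDiscriminantInt = (integralModelInt W).c₄ ^ 3 - (integralModelInt W).c₆ ^ 2 :=
    (integralModelInt W).c_relation
  -- `3^{3a} x³ − 3^{2b} y² = 1728 · 3^v · Δ′` with `3a + 6 = 2b + v`, `2b = v + 2`:
  -- divide by `3^{v+2} = 3^{2b}`: `192 Δ′ = 3^{3a − 2b} … ` — here `3a = 2b + v − 6 = 2b + (2b − 2) − 6`, i.e.
  -- on both rows `3a = v + 2 + (v − 4)/… `; concretely (a,b,v) = (2,3,4): 3⁶x³ − 3⁶y² = 1728·3⁴Δ′;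
  -- (4,6,10): 3¹²x³ − 3¹²y² = 1728·3¹⁰Δ′. Both: `9(x³ − y²) = 1728 Δ′`, `x³ − y² = 192 Δ′`.
  have hker : 192 * minimalDiscUnitPartThree W = x ^ 3 - y ^ 2 := by
    rw [hx, hy, hD] at hrel
    have e1 : ((3 : ℤ) ^ a * x) ^ 3 = 3 ^ (2 * b) * x ^ 3 := by
      rw [mul_pow, ← pow_mul, show a * 3 = 2 * b by omega]
    have e2 : ((3 : ℤ) ^ b * y) ^ 2 = 3 ^ (2 * b) * y ^ 2 := by rw [mul_pow, ← pow_mul, mul_comm b 2]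
    have e3 : (3 : ℤ) ^ (2 * b) = 3 ^ v * 9 := by
      rw [show 2 * b = v + 2 by omega, pow_add]; norm_num
    rw [e1, e2, e3] at hrel
    have h3 : (3 : ℤ) ^ v ≠ 0 := pow_ne_zero _ (by norm_num)
    have : (3 : ℤ) ^ v * (1728 * minimalDiscUnitPartThree W) = 3 ^ v * (9 * (x ^ 3 - y ^ 2)) := by
      linear_combination hrel
    have h9 := mul_left_cancel₀ h3 this
    have : (9 : ℤ) * (192 * minimalDiscUnitPartThree W) = 9 * (x ^ 3 - y ^ 2) := by linear_combination h9
    exact mul_left_cancel₀ (by norm_num) this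
  exact emod_nine_eq_four_or_five_of_kernel hx3 hy3 hps hker

/-- **`a_w` on the principal-series rows of K1/K2** (`ClassO6 W 3`, `v = v₃(Δ_min)` even, `Δ′ ≡ 1 (mod 3)`), the
binder shape of `PSRankOneLowerHalfAtThree` / `PSRankOneUpperHalfAtThree`: the four-row closed form of
`psUntwistedTrace_of_even`. [cite: Kraus1990, Théorème (p = 3)] [cite: Tate1975, §7] -/
theorem psUntwistedTrace_of_psRow (hO6 : ClassO6 W 3) (hev : Even (padicValInt 3 W.minimalDiscriminantInt))
    (_hps : W.minimalDiscriminantInt / 3 ^ padicValInt 3 W.minimalDiscriminantInt % 3 = 1) :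
    W.psUntwistedTrace =
      if padicValInt 3 W.minimalDiscriminantInt = 4 then
        3 * signNine ((integralModelInt W).c₆ / 3 ^ padicValInt 3 (integralModelInt W).c₆ % 9) *
          epsNine (minimalDiscUnitPartThree W % 9)
      else if padicValInt 3 W.minimalDiscriminantInt = 6 then
        traceTableIV ((integralModelInt W).c₆ / 3 ^ padicValInt 3 (integralModelInt W).c₆ % 9)
      else if padicValInt 3 W.minimalDiscriminantInt = 10 then
        -3 * signNine ((integralModelInt W).c₆ / 3 ^ padicValInt 3 (integralModelInt W).c₆ % 9) *
          epsNine (minimalDiscUnitPartThree W % 9)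
      else -traceTableIV ((integralModelInt W).c₆ / 3 ^ padicValInt 3 (integralModelInt W).c₆ % 9) :=
  psUntwistedTrace_of_even W hO6.2.1 hO6.2.2 hev

/-- **The `a_w = 0` sub-row on Kodaira `II`/`IV*`** (`v₃Δ_min ∈ {4, 10}`, untwisting character of order `3` on
`II`, `6` on `IV*`): on the principal-series rows, `a_w(W) = 0 ⟺ Δ′ ≡ 7 (mod 9)` — the curve-side predicate of
memo LAW-La3 §8 (there `ℚ₃(E[2]) = ℚ₃(ζ₉)⁺`, `α² = −3`). [cite: Kraus1990, Théorème (p = 3)] -/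
theorem psUntwistedTrace_eq_zero_iff_of_psRow_II_IVstar (hO6 : ClassO6 W 3)
    (hv : padicValInt 3 W.minimalDiscriminantInt = 4 ∨ padicValInt 3 W.minimalDiscriminantInt = 10)
    (hps : W.minimalDiscriminantInt / 3 ^ padicValInt 3 W.minimalDiscriminantInt % 3 = 1) :
    W.psUntwistedTrace = 0 ↔ minimalDiscUnitPartThree W % 9 = 7 := by
  have hps' : minimalDiscUnitPartThree W % 3 = 1 := hps
  have hev : Even (padicValInt 3 W.minimalDiscriminantInt) := by
    rcases hv with h | h <;> rw [h] <;> decide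
  have hf := (PSKodairaDictionary.condExp_eq_four_iff_even W hO6.2.1 hO6.2.2).mpr hev
  have hsgn := signNine_of_eq_four_or_five (c₆_unitPart_emod_nine_of_psRow_II_IVstar W hf hv hps')
  have heps := epsNine_eq_zero_iff_of_mem (emod_nine_of_emod_three_eq_one hps')
  rw [psUntwistedTrace_of_psRow W hO6 hev hps]
  rcases hv with h | h
  · rw [if_pos h, ← heps]
    rcases hsgn with hs | hs <;> rw [hs] <;> omega
  · rw [if_neg (by omega), if_neg (by omega), if_pos h, ← heps]
    rcases hsgn with hs | hs <;> rw [hs] <;> omega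

/-- **The `a_w = 0` sub-row on Kodaira `IV`/`II*`** (`v₃Δ_min ∈ {6, 12}`): on the cyclic wild cell,
`a_w(W) = 0 ⟺ c₆ᵘ ≡ ±4 (mod 9)` (`c₆ᵘ` the unit part of `c₆(W_ℤ)`) — memo LAW-La3 §8.
[cite: Kraus1990, Théorème (p = 3)] -/
theorem psUntwistedTrace_eq_zero_iff_of_even_IV_IIstar (hadd : Addv W 3) (hW : SubW W 3)
    (hv : padicValInt 3 W.minimalDiscriminantInt = 6 ∨ padicValInt 3 W.minimalDiscriminantInt = 12) :
    W.psUntwistedTrace = 0 ↔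
      ((integralModelInt W).c₆ / 3 ^ padicValInt 3 (integralModelInt W).c₆ % 9 = 4 ∨
        (integralModelInt W).c₆ / 3 ^ padicValInt 3 (integralModelInt W).c₆ % 9 = 5) := by
  have hev : Even (padicValInt 3 W.minimalDiscriminantInt) := by
    rcases hv with h | h <;> rw [h] <;> decide
  have h0 := integralModelInt_c₆_ne_zero_of_even W hadd hW hev
  obtain ⟨y, hy, hy3⟩ := exists_eq_pow_mul_not_dvd h0
  have hyq : (integralModelInt W).c₆ / 3 ^ padicValInt 3 (integralModelInt W).c₆ = y :=
    Int.ediv_eq_of_eq_mul_right (pow_ne_zero _ (by norm_num)) hy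
  have hunit := traceTableIV_eq_zero_iff_of_unit (emod_nine_of_not_three_dvd hy3)
  rw [psUntwistedTrace_of_even W hadd hW hev, hyq]
  rcases hv with h | h
  · rw [if_neg (by omega), if_pos h]
    exact hunit
  · rw [if_neg (by omega), if_neg (by omega), if_neg (by omega), neg_eq_zero]
    exact hunit

end Curves

end Summit.BirchSwinnertonDyer.BirchSwinnertonDyer.Theorems.PSUntwistedTrace
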